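import Summits.AnomalousDissipation.AnomalousDissipation.Theorems.SolenoidalFractalHomogenisationLagrangianStepD1TailCrushCases
import HarnessLib

/-!
# K1L_D `stub_D1_V0thg` (stmt-AnomalousDissipation-27980), R3′ lane, R3′-2 `D1TailCrushBound`: THE CRUSHED CLASS — a pickup slot lying cyclically
# after the first hopper of the source reads a crushed state (helper; `--supports stmt-AnomalousDissipation-27980 --as helper`)

Helper file of route `SolenoidalFractalHomogenisation` (one-generation hand `leafhand-ad-solenoidalfractalh-1` g1, road E-c).  The R3′ plan memo's CRUSHED
class (`Lines/onelevel-vtheta-R3-plan.md` §2, «everything else»): pickup `j ≠ j'` without fresh part and a slot `i` hopping `m_{j'}` with static slots between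
`j'` and `i`, lying cyclically strictly between the source `j'` and the pickup `j` — in the three period placements `j' < i < j`, `j < j' < i` (pickup in the
next period) and `i < j < j'` (source in the previous period).  Along the pickup slot the response is then bounded by the CRUSHED STATE at the end of slot `i`
(`D1Tail.crushed_state` + plain contraction, the source being off from the end of `i` to the pickup), and `tail_bound_far_core_eps` ends the game:
* **`tail_bound_hopper_class_eps`** — ν-free `C > 0`, `r₁ ∈ (0, 1/4]` with `|tailKernel ν S p q j j'| ≤ C·√ν·gTail j j'·(√PpSq_j(p)·√PpSq_{j'}(q))`, `ν = r³ ≤ r₁³`.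
What is NOT here: the classification of the 676 pairs (`first_hopper` + `LadderCrush.pair_census`) and the assembly into `RelSmall` via
`residueTail_of_crushedSlotPairBounds_gTail`.  No definitions, no sorry.  NOT a proof of `stub_D1_V0thg`, of K1L_D or of AD; rung F-D1.A0 infrastructure.
-/

set_option linter.dupNamespace false

noncomputable section

namespace Summit.AnomalousDissipation.AnomalousDissipation.Theorems.SolenoidalFractalHomogenisation.LagrangianStep.D1Tail

open Summit.AnomalousDissipation.AnomalousDissipation.Theorems
open Summit.AnomalousDissipation.AnomalousDissipation.Theorems.SolenoidalFractalHomogenisation.LagrangianStep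
open Summit.AnomalousDissipation.AnomalousDissipation.Theorems.SolenoidalFractalHomogenisation.LagrangianStep.WCrossing
open Summit.AnomalousDissipation.AnomalousDissipation.Theorems.SolenoidalFractalHomogenisation.LagrangianStep.D1TailCert
open Summit.AnomalousDissipation.AnomalousDissipation.Theorems.SolenoidalFractalHomogenisation.LagrangianStep.D1ResidueCert
open Summit.AnomalousDissipation.AnomalousDissipation.Theorems.SolenoidalFractalHomogenisation.LagrangianStep.Sideband
open Summit.AnomalousDissipation.AnomalousDissipation.Theorems.SolenoidalFractalHomogenisation.PermissibleCarrier
  (period_pos start_nonneg start_add_tau_le_period)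
open Summit.AnomalousDissipation.AnomalousDissipation.Theorems.SolenoidalFractalHomogenisation.RealisedQuasiStaticCellLaw (start_add_tau_le_start)
open Literature.Analysis Literature.Analysis.FluidPDE Literature.Analysis.FunctionSpaces Literature.Analysis.FunctionSpaces.Torus
open Literature.Analysis.FluidPDE.Torus Literature.Analysis.FluidPDE.LatticeShear
open Set Real Complex
open scoped InnerProductSpace

set_option maxHeartbeats 400000 in -- pre-budgeted (ops-buildfix rule): large statement, three period placements
/-- **THE CRUSHED (HOPPER) CLASS.**  Source `j'`, a slot `i ≠ j'` hopping `m_{j'}` with every slot cyclically strictly between `j'` and `i` static, and a pickup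
`j ≠ j'` lying cyclically strictly after `i` and before the next occurrence of `j'` (`j' < i < j`, or `j < j' < i`, or `i < j < j'`).  Then ν-free `C > 0`,
`r₁ ∈ (0, 1/4]` with `|tailKernel ν S p q j j'| ≤ C·√ν·gTail j j'·(√PpSq_j(p)·√PpSq_{j'}(q))` for `ν = r³ ≤ r₁³`, every block-window background without fresh
part for the pair. [cite: BedrossianCotiZelati2017, §2 (hypocoercivity, enhanced dissipation)] [cite: ArmstrongVicol2025, §3] [cite: SandersVerhulstMurdock2007, Lemma 5.2.7] -/
theorem tail_bound_hopper_class_eps {j j' i : Fin 26} (hij : i ≠ j')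
    (hhop : (slots i).v 0 * (slots j').m 0 + (slots i).v 1 * (slots j').m 1 + (slots i).v 2 * (slots j').m 2 ≠ 0)
    (hstat : ∀ l : Fin 26, l ≠ j' → ((j' < l ∧ l < i) ∨ (i < j' ∧ (j' < l ∨ l < i))) →
      (slots l).v 0 * (slots j').m 0 + (slots l).v 1 * (slots j').m 1 + (slots l).v 2 * (slots j').m 2 = 0)
    (hbetween : (j' < i ∧ i < j) ∨ (j < j' ∧ j' < i) ∨ (i < j ∧ j < j')) :
    ∃ C r₁ : ℝ, 0 < C ∧ 0 < r₁ ∧ r₁ ≤ 1 / 4 ∧ ∀ {r : ℝ} (hr : 0 < r), r ≤ r₁ →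
      ∀ {S : T4}, Torus.NearIso S (10 / 11) (11 / 10) → ∀ τ ∈ Icc (0:ℝ) (1 / 20), OddSectorial S τ → freshMat S j j' = 0 → ∀ p q : Fin 3 → ℝ,
      |tailKernel (r ^ 3) S p q j j'| ≤ C * Real.sqrt (r ^ 3) * (gTail j j' * (Real.sqrt (PpSq j p) * Real.sqrt (PpSq j' q))) := by
  obtain ⟨C, r₁, hC, hr₁, hr₁4, hcrush⟩ := crushed_state j' i hij hhop hstat
  refine ⟨C * Real.exp θmin, r₁, by positivity, hr₁, hr₁4, ?_⟩
  intro r hr hr1 S hS τ hτw hodd hfresh p q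
  have hν0 : 0 < r ^ 3 := pow_pos hr 3
  have hν40 : r ^ 3 ≤ 1 / 40 := by
    have h := pow_le_pow_left₀ hr.le (hr1.trans hr₁4) 3
    linarith [show ((1:ℝ) / 4) ^ 3 ≤ 1 / 40 by norm_num]
  set W₁ := (cubatureWord.stretch MB MB_pos).stretch (1 / r ^ 3) (one_div_pos.mpr hν0) with hW₁
  set qC : EuclideanSpace ℂ (Fin 3) := WithLp.toLp 2 fun i => ((q i : ℝ) : ℂ) with hqC
  have h𝔸 : Torus.NearIso (r ^ 3 • S) (r ^ 3 * (10 / 11)) (r ^ 3 * (11 / 10)) := hS.smul hν0.le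
  have hlo : (0:ℝ) ≤ r ^ 3 * (10 / 11) := by positivity
  have hN := isPeriodicResponse_cubature hν0 hS j'
  -- the crushed state at the end `e` of the hopping slot
  have he := hcrush hr hr1 hS τ hτw hodd qC
  have hτi : (W₁.phase i).τ = 1 / r ^ 3 * ((cubatureWord.stretch MB MB_pos).phase i).τ := rfl
  -- plain contraction from `e` to any later time before the source switches on again
  have hcontr : ∀ {b : ℝ}, W₁.start i + (W₁.phase i).τ ≤ b → (∀ u ∈ Ico (W₁.start i + (W₁.phase i).τ) b, slotEnvelope W₁ j' u = 0) →
      ‖responseExt W₁ (r ^ 3 • S) 1 (R0 (r ^ 3)) j' b qC‖ ≤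
        C * Real.sqrt (r ^ 3) * (8 * π * ‖slotAmp W₁ j'‖ / min (1:ℝ) (4 * π ^ 2 * (r ^ 3 * (10 / 11))) * ‖transversalProj (cubatureWord.phase j').m qC‖) := by
    intro b hb henv
    have h := norm_responseExt_le_exp_of_envelope_zero W₁ h𝔸 hlo 1 (R0 (r ^ 3)) j' hN qC hb henv
    refine h.trans ((mul_le_of_le_one_left (norm_nonneg _) ?_).trans (by rw [hτi]; exact he))
    rw [Real.exp_le_one_iff, neg_nonpos]
    exact mul_nonneg (le_min zero_le_one (by positivity)) (sub_nonneg.2 hb)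
  -- the state along the pickup slot, in the three placements
  have hstate : ∀ t ∈ Icc (W₁.start j) (W₁.start j + (W₁.phase j).τ), ‖responseExt W₁ (r ^ 3 • S) 1 (R0 (r ^ 3)) j' t qC‖ ≤
      C * Real.sqrt (r ^ 3) * (8 * π * ‖slotAmp W₁ j'‖ / min (1:ℝ) (4 * π ^ 2 * (r ^ 3 * (10 / 11))) * ‖transversalProj (cubatureWord.phase j').m qC‖) := by
    intro t ht
    rcases hbetween with ⟨h1, h2⟩ | ⟨h1, h2⟩ | ⟨h1, h2⟩
    · -- `j' < i < j`
      have hej : W₁.start i + (W₁.phase i).τ ≤ W₁.start j := start_add_tau_le_start W₁ h2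
      refine hcontr (hej.trans ht.1) fun u hu => hsrc_of_lt W₁ h1 u ⟨?_, ?_⟩
      · exact (le_add_of_nonneg_right (W₁.phase i).τ_pos.le).trans hu.1
      · exact hu.2.le.trans (ht.2.trans ((start_add_tau_le_period W₁ j).trans (le_add_of_nonneg_left (start_nonneg W₁ j'))))
    · -- `j < j' < i`: the pickup in the next period
      rw [← responseExt_add_period]
      have heP : W₁.start i + (W₁.phase i).τ ≤ t + W₁.period :=
        (start_add_tau_le_period W₁ i).trans (le_add_of_nonneg_left ((start_nonneg W₁ j).trans ht.1))
      refine hcontr heP fun u hu => hsrc_of_lt W₁ h2 u ⟨?_, ?_⟩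
      · exact (le_add_of_nonneg_right (W₁.phase i).τ_pos.le).trans hu.1
      · have : t ≤ W₁.start j' := ht.2.trans (start_add_tau_le_start W₁ h1)
        linarith [hu.2]
    · -- `i < j < j'`: the source in the previous period
      have hej : W₁.start i + (W₁.phase i).τ ≤ W₁.start j := start_add_tau_le_start W₁ h1
      refine hcontr (hej.trans ht.1) fun u hu => ?_
      have h := hsrc_of_gt W₁ j' i u ⟨(le_add_of_nonneg_right (W₁.phase i).τ_pos.le).trans hu.1, ?_⟩
      · exact h
      · rw [sub_add_cancel]
        exact hu.2.le.trans (ht.2.trans (start_add_tau_le_start W₁ h2))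
  have hfin := tail_bound_far_core_eps ⟨hν0, hν40⟩ hS p q hfresh (C * Real.sqrt (r ^ 3)) hstate
  calc |tailKernel (r ^ 3) S p q j j'| ≤ C * Real.sqrt (r ^ 3) * Real.exp θmin * gTail j j' * (Real.sqrt (PpSq j p) * Real.sqrt (PpSq j' q)) := hfin
    _ = C * Real.exp θmin * Real.sqrt (r ^ 3) * (gTail j j' * (Real.sqrt (PpSq j p) * Real.sqrt (PpSq j' q))) := by ring

end Summit.AnomalousDissipation.AnomalousDissipation.Theorems.SolenoidalFractalHomogenisation.LagrangianStep.D1Tail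

end
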